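import Literature.NumberTheory.Automorphic.HyperspecialUnitarySatakeInjective
import Literature.NumberTheory.Automorphic.SphericalHeckeEigenvaluesGL
import HarnessLib

/-!
# Unramified Hecke eigencharacters of `ℋ(U(σ, J₀), K₀)` through the Satake transform; `ℋ(U(σ, J₀), K₀)` has no
# zero-divisors (Cartier 1979 §IV (4.2)–(4.4); Mínguez 2011 §4)

Topic `NumberTheory/Automorphic`; namespace `Literature.NumberTheory.Automorphic.HermitianLattice.UnramifiedLocalConjDatum`
(lane `lit-hodgefound`, Track 2 foundations; seat `lit-hodgefound-p11`, generation 36, row g36-#9).  ONE definition with a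
body (`UnramifiedLocalConjDatum.heckeEigencharacter`) + theorems; no named fact, no instance, no notation.  Sequel of
`HyperspecialUnitarySatakeTransform` / `HyperspecialUnitarySatakeInjective`; REUSES `laurentEvalAt` (evaluation
`ℂ[ℤ^N] →ₐ[ℂ] ℂ` at a point of `(ℂˣ)^N`) of the tree's `SphericalHeckeEigenvaluesGL`.

Setting: `K` a field with `Valued K ℤᵐ⁰` and finite residue field of cardinality `q`, `UnramifiedLocalConjDatum σ ϖ`,
`G = U(σ, J₀)`, `K₀ = U(σ, J₀) ∩ GL_N(𝒪)`, `𝒮 = satakeTransform : ℋ(G, K₀) →ₐ[ℂ] ℂ[ℤ^N]`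
(`𝒮(T) = ∑_γ (T[K₀])(γ) q^{-⟨ν, a(γ)⟩/2} x^{a(γ)}`), `β ∈ (ℂˣ)^N` torus parameters.

## The print

[CartierCorvallis1979] §IV (4.2)–(4.4) (p. 147–149): the unramified character `χ` of `M` defines the spherical
representation `I(χ)`, and `ℋ(G, K)` acts on its `K`-fixed line by the character `f ↦ (Sf)(χ)` — «the algebra
homomorphisms from `ℋ(G, K)` to `ℂ` are the maps `f ↦ ∫ Sf(m) χ(m) dm`» (Cor. 4.2 for ALL characters, via the Satake
isomorphism; here only the direction «`χ ↦ (f ↦ Sf(χ))` IS an algebra homomorphism», which needs the homomorphism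
half alone); explicitly, on the characteristic function of `K t K`,
`λ_χ(𝟙_{KtK}) = ∑_{yK ⊆ KtK} (χ δ^{1/2})(m_y)` (`y = n_y m_y k_y`).  [Minguez2011] §4 (the unramified
representations of unitary groups and their Satake parameters).  [Satake1963] §6: «`L(G, U)` is an integral domain»
— here for `U(σ, J₀)` from the injectivity of `𝒮` into the domain `ℂ[ℤ^N]`.

## What is formalised

* §1 `coeff_satakeVec_eq_zero_of_ne_neg`, `coeff_satakeTransform_eq_zero_of_ne_neg` — the exponents occurring in
  `𝒮(T)` are cocharacters of the torus of `U(σ, J₀)`: `μ ∘ rev = -μ`.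
* §2 **`noZeroDivisors_heckeAlgebra_unitary`** — `ℋ(U(σ, J₀), K₀)` (over `ℂ`) has no zero-divisors.
* §3 **`UnramifiedLocalConjDatum.heckeEigencharacter β : ℋ(U(σ, J₀), K₀) →ₐ[ℂ] ℂ`**, `T ↦ 𝒮(T)(β)` — THE UNRAMIFIED
  HECKE EIGENCHARACTER WITH TORUS PARAMETER `β` IS AN ALGEBRA HOMOMORPHISM — with `heckeEigencharacter_apply`,
  `laurentEvalAt_satakeTransform_doubleCosetOperator` and **`heckeEigencharacter_doubleCosetOperator`**:
  `λ_β(T_g) = ∑_{α ∈ K₀gK₀/K₀} q^{-⟨ν, a(α)⟩/2} ∏_i β_i^{a(α)_i}` — the explicit «`∑_{y ∈ KtK/K} (χ_β δ_B^{1/2})(b_y)`»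
  of the number-field literature (`UnitaryGroupAutomorphicRep.heckeEigenvalue` has this shape), and
  `heckeEigencharacter_one`.

## References
* [CartierCorvallis1979] P. Cartier, *Representations of 𝔭-adic groups: a survey*, PSPM 33.1 (1979), §IV (4.2)–(4.4),
  Cor. 4.2.
* [Minguez2011] A. Mínguez, *Unramified representations of unitary groups*, in: On the stabilization of the trace
  formula (2011), §4.
* [Satake1963] I. Satake, *Theory of spherical functions on reductive algebraic groups over 𝔭-adic fields*,
  Publ. Math. IHÉS 18 (1963), §6.
-/

noncomputable section

open scoped Valued WithZero Matrix MatrixGroups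
open MonoidAlgebra Representation Finset

namespace Literature.NumberTheory.Automorphic.HermitianLattice

open Literature.NumberTheory.Automorphic.CartanUnique Literature.NumberTheory.Automorphic.SymplecticCartan

variable {K : Type*} [Field K] [Valued K ℤᵐ⁰] {σ : K →+* K} {ϖ : K} {N : ℕ}

namespace UnramifiedLocalConjDatum

/-! ## §1 The exponents of `𝒮(T)` are cocharacters: `μ ∘ rev = -μ` -/

/-- Only antisymmetric exponents `μ` (`μ (rev i) = -μ i`) occur in `satakeVec v`. [cite: Minguez2011, §4]
[cite: CartierCorvallis1979, §IV (4.2)] -/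
theorem coeff_satakeVec_eq_zero_of_ne_neg (hd : UnramifiedLocalConjDatum σ ϖ)
    (v : MonoidAlgebra ℂ (unitaryGroupOfForm σ ((StdForm.antidiagonal N).over K) ⧸ unitaryInt σ ((StdForm.antidiagonal N).over K)))
    {μ : Fin N → ℤ} {i : Fin N} (hμ : μ (Fin.rev i) ≠ -μ i) : (hd.satakeVec v).coeff μ = 0 := by
  classical
  rw [hd.coeff_satakeVec v μ]
  refine Finset.sum_eq_zero fun γ _ => ?_
  rw [if_neg]
  intro h
  apply hμ
  rw [← h, hd.iwasawaExp_rev]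

variable [Finite 𝓀[K]]

/-- Only antisymmetric exponents occur in `𝒮(T)`: the Satake transform lands in the group algebra of the cocharacter
lattice `{μ ∈ ℤ^N : μ ∘ rev = -μ}` of the maximal split torus of `U(σ, J₀)`. [cite: Minguez2011, §4]
[cite: CartierCorvallis1979, §IV (4.2)] -/
theorem coeff_satakeTransform_eq_zero_of_ne_neg (hd : UnramifiedLocalConjDatum σ ϖ)
    (T : heckeAlgebra ℂ (unitaryGroupOfForm σ ((StdForm.antidiagonal N).over K)) (unitaryInt σ ((StdForm.antidiagonal N).over K)))
    {μ : Fin N → ℤ} {i : Fin N} (hμ : μ (Fin.rev i) ≠ -μ i) : (hd.satakeTransform T).coeff μ = 0 := by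
  rw [satakeTransform_apply]
  exact hd.coeff_satakeVec_eq_zero_of_ne_neg _ hμ

/-! ## §2 `ℋ(U(σ, J₀), K₀)` has no zero-divisors -/

/-- **`ℋ(U(σ, J₀), K₀)` has no zero-divisors** («`L(G, U)` is an integral domain»): the Satake transform embeds it
into the domain `ℂ[ℤ^N]` (`satakeTransform_injective`). [cite: Satake1963, §6] [cite: CartierCorvallis1979, §IV Thm. 4.1] -/
theorem noZeroDivisors_heckeAlgebra_unitary (hd : UnramifiedLocalConjDatum σ ϖ) :
    NoZeroDivisors (heckeAlgebra ℂ (unitaryGroupOfForm σ ((StdForm.antidiagonal N).over K))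
      (unitaryInt σ ((StdForm.antidiagonal N).over K))) :=
  hd.satakeTransform_injective.noZeroDivisors _ (map_zero _) (map_mul _)

/-! ## §3 The unramified Hecke eigencharacters `λ_β = ev_β ∘ 𝒮` -/

/-- **The unramified Hecke eigencharacter with torus parameter `β ∈ (ℂˣ)^N`**: the algebra homomorphism
`λ_β : ℋ(U(σ, J₀), K₀) →ₐ[ℂ] ℂ`, `T ↦ 𝒮(T)(β) = ∑_γ (T[K₀])(γ) q^{-⟨ν, a(γ)⟩/2} β^{a(γ)}` — Cartier's `f ↦ Sf(χ)`, the
eigenvalue system of `ℋ(G, K)` on the spherical line of the unramified principal series with parameter `χ = χ_β`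
(only `β_i β_{rev i}`, resp. the first half of `β`, matters: §1). [cite: CartierCorvallis1979, §IV (4.2)–(4.4)]
[cite: Minguez2011, §4] -/
def heckeEigencharacter (hd : UnramifiedLocalConjDatum σ ϖ) (β : Fin N → ℂˣ) :
    heckeAlgebra ℂ (unitaryGroupOfForm σ ((StdForm.antidiagonal N).over K)) (unitaryInt σ ((StdForm.antidiagonal N).over K))
      →ₐ[ℂ] ℂ :=
  (laurentEvalAt β).comp hd.satakeTransform

/-- Unfolding: `λ_β(T) = 𝒮(T)(β)`. [cite: CartierCorvallis1979, §IV (4.2)] -/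
theorem heckeEigencharacter_apply (hd : UnramifiedLocalConjDatum σ ϖ) (β : Fin N → ℂˣ)
    (T : heckeAlgebra ℂ (unitaryGroupOfForm σ ((StdForm.antidiagonal N).over K)) (unitaryInt σ ((StdForm.antidiagonal N).over K))) :
    hd.heckeEigencharacter β T = laurentEvalAt β (hd.satakeTransform T) :=
  rfl

/-- `λ_β(1) = 1`. [cite: CartierCorvallis1979, §IV (4.2)] -/
theorem heckeEigencharacter_one (hd : UnramifiedLocalConjDatum σ ϖ) (β : Fin N → ℂˣ) :
    hd.heckeEigencharacter β 1 = 1 :=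
  map_one _

/-- `λ_β` is multiplicative (it is an algebra homomorphism). [cite: CartierCorvallis1979, §IV (4.2)–(4.4)] -/
theorem heckeEigencharacter_mul (hd : UnramifiedLocalConjDatum σ ϖ) (β : Fin N → ℂˣ)
    (S T : heckeAlgebra ℂ (unitaryGroupOfForm σ ((StdForm.antidiagonal N).over K)) (unitaryInt σ ((StdForm.antidiagonal N).over K))) :
    hd.heckeEigencharacter β (S * T) = hd.heckeEigencharacter β S * hd.heckeEigencharacter β T :=
  map_mul _ S T

/-- **`𝒮(T_g)(β)` as an orbit sum**: `𝒮(T_g)(β) = ∑_{α ∈ K₀gK₀/K₀} q^{-⟨ν, a(α)⟩/2} ∏_i β_i^{a(α)_i}`.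
[cite: CartierCorvallis1979, §IV (4.2)] [cite: Minguez2011, §4] -/
theorem laurentEvalAt_satakeTransform_doubleCosetOperator (hd : UnramifiedLocalConjDatum σ ϖ)
    [IsHeckeTriple (⊤ : Submonoid (unitaryGroupOfForm σ ((StdForm.antidiagonal N).over K)))
      (unitaryInt σ ((StdForm.antidiagonal N).over K)) (unitaryInt σ ((StdForm.antidiagonal N).over K))]
    (β : Fin N → ℂˣ) (g : unitaryGroupOfForm σ ((StdForm.antidiagonal N).over K)) :
    laurentEvalAt β (hd.satakeTransform (heckeAlgebra.doubleCosetOperator (unitaryInt σ ((StdForm.antidiagonal N).over K)) g)) =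
      ∑ α ∈ (finite_orbit_quotient (unitaryInt σ ((StdForm.antidiagonal N).over K)) g).toFinset,
        satakeWeight (residueCardSqrt K) (hd.iwasawaExp α.out) * ∏ i, (β i : ℂ) ^ (hd.iwasawaExp α.out i) := by
  rw [satakeTransform_doubleCosetOperator, map_sum]
  exact Finset.sum_congr rfl fun α _ => by rw [laurentEvalAt_single]

/-- **The unramified Hecke eigenvalue of `T_g = [K₀ g K₀]`**:
`λ_β(T_g) = ∑_{α ∈ K₀gK₀/K₀} q^{-⟨ν, a(α)⟩/2} ∏_i β_i^{a(α)_i}` — «`∑_{yK ⊆ KtK} (χ_β δ_B^{1/2})(b_y)`», the shape of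
`UnitaryGroupAutomorphicRep.heckeEigenvalue`. [cite: CartierCorvallis1979, §IV (4.2)] [cite: Minguez2011, §4] -/
theorem heckeEigencharacter_doubleCosetOperator (hd : UnramifiedLocalConjDatum σ ϖ)
    [IsHeckeTriple (⊤ : Submonoid (unitaryGroupOfForm σ ((StdForm.antidiagonal N).over K)))
      (unitaryInt σ ((StdForm.antidiagonal N).over K)) (unitaryInt σ ((StdForm.antidiagonal N).over K))]
    (β : Fin N → ℂˣ) (g : unitaryGroupOfForm σ ((StdForm.antidiagonal N).over K)) :
    hd.heckeEigencharacter β (heckeAlgebra.doubleCosetOperator (unitaryInt σ ((StdForm.antidiagonal N).over K)) g) =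
      ∑ α ∈ (finite_orbit_quotient (unitaryInt σ ((StdForm.antidiagonal N).over K)) g).toFinset,
        satakeWeight (residueCardSqrt K) (hd.iwasawaExp α.out) * ∏ i, (β i : ℂ) ^ (hd.iwasawaExp α.out i) :=
  hd.laurentEvalAt_satakeTransform_doubleCosetOperator β g

end UnramifiedLocalConjDatum

end Literature.NumberTheory.Automorphic.HermitianLattice

end
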